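import Summits.ABC.StewartYu.PadicG3OddCeilings
import Literature.NumberTheory.Transcendental.Waldschmidt1980SizeHyp
import HarnessLib

/-!
# Cell abc-stewartyu, crux `Y07Odd` (stmt-ABC-19658), line `gen3-slab-odd`: the Kummer HALF-STEP GAIN LINE from SLOT CEILINGS
# (generic layer over an abstract schedule `Sc : G3Sched n`; sharp half-point clearing `DCs`/`MhCs` of p5-g4's (S1))

`Summits/ABC/StewartYu/PadicG3HalfSlots.lean` — cell `abc-stewartyu` (HOME `run/shared/lean/pub/abc-stewartyu/`), seat p4 (g4); route-holder
assignment 2026-08-27T06:05:51Z/06:30:13Z (`hgainH`).  Theorems only; no named fact; no numbers; no schedule instance.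

The half-step conjunct `hH` of `IneqPackR₃` (`PadicG3RecordR3`) is, by p5-g4's `hH_of_lines` / lp-1's `hH_of_lamLines`, the GAIN LINE
`log BwP + 2^{n+1}·(log 4 + 2·log DCs + log(1 + U·P·MhCs) + 3·log ∏H(α)) − log DCs < (2·NS lev n + 1)·tS lev·((m+½)·log p)`
at every admissible `(lev, s₁, τ)`.  This file reduces that line ONCE, for every schedule, to real SLOT CEILINGS the parameter families bound in
their own currency (p1 g8 / p4 at `sched1b b` in `G·X·L`; p3-g7 at `schedVb b` in `Zp`):
* `cν ≥ log ν(H)` (symbolic `Nat.lcmUpto`; take `(23/20)·H` from `NWPi.log_lcmUpto_le`), `cU ≥ log UcardS₂`, `cA ≥ log AmaxS₂`,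
  `cX lev ≥ log max(1, XbC (Lb side lev))`, `cS lev ≥ Σⱼ Lb side lev j · Vⱼ` (the box height at level `lev`, `h(αⱼ) ≤ Vⱼ`),
  `cL lev ≥ L₀·(1 + log(1 + 2^{Ŝ−lev−1}|s₁|/H))` on the odd half-nodes `|s₁| ≤ 2·NhS (lev+1) − 1`, `Tq lev ≥ TordS lev n − tS lev` (the order budget);
* **`hgainH_of_slots`**: if for every `lev < Ŝ`
  `log BwP + 2^{n+1}·(log 4 + 3 log 2 + 2cU + cA + H/e + 3ΣV + cL lev + Tq lev·max(3cν + (Ŝ−lev)·log 2, 2W + cX lev) + 4·(2·NhS(lev+1) − 1)·cS lev)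
   < (2·NS lev n + 1)·tS lev·((m+½)·log p)`, then `hgainH` holds verbatim (the shape consumed by `hH_of_lines` / `hH_of_lamLines` / `ineqPackR₃_of_lines`).
The per-degree decomposition (`log_DCs_split`, the joint height charge `2·log halfDen + log halfHgtR ≤ 4|s₁|·Σ Lbⱼ Vⱼ` of (S1), p5's
`log_one_add_UPMhCs_le` / `log_M0C_le'` / `log_PmaxS₂_le`, `log ∏H(α) = Σ h(αⱼ)` (`log_heightProd_le_of_le`)) is `perDegreeH_le`.

WHAT THIS IS NOT: no budget inequality, no schedule; no crux move.

References: Yu. V. Nesterenko, LNM 1819 (2003) §4.3 (4.39)–(4.45); K. Yu, Acta Math. 211 (2013) (5.35)–(5.39).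
-/

noncomputable section

open NormedSpace Finset Polynomial
open Literature.NumberTheory.Transcendental
open Literature.NumberTheory.Transcendental.PadicCW77 (condExp)
open Literature.NumberTheory.Transcendental.CW77.Setup (Tau tauNorm)
open scoped Nat

namespace Summit.ABC.StewartYu

namespace G3Setup

variable {p : ℕ} [Fact p.Prime] (S : G3Setup p) (Sc : G3Sched S.n)

/-! ### Small facts -/

/-- `1 ≤ UcardS₂`. [folklore] -/
private theorem UcardS₂_one_le : 1 ≤ S.UcardS₂ Sc := by
  unfold UcardS₂
  exact one_le_mul (by omega) (Finset.one_le_prod' fun j _ => by omega)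

/-- `log |b_{j₀}| ≤ W` (as the natural number `natAbs b_{j₀} ≥ 1`). [folklore] -/
theorem log_natAbs_bj₀_le {W : ℝ} (hWb : ∀ j, Real.log (max 3 (|S.b j| : ℝ)) ≤ W) :
    Real.log (((S.b S.j₀).natAbs : ℕ) : ℝ) ≤ W := by
  have h := S.abs_b_le_exp hWb S.j₀
  rw [Nat.cast_natAbs, Int.cast_abs]
  have h3 : (0 : ℝ) < |((S.b S.j₀ : ℤ) : ℝ)| := by
    have : (S.b S.j₀ : ℝ) ≠ 0 := by exact_mod_cast S.bj₀_ne
    exact abs_pos.mpr this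
  calc Real.log |((S.b S.j₀ : ℤ) : ℝ)| ≤ Real.log (Real.exp W) := Real.log_le_log h3 h
    _ = W := Real.log_exp W

/-- `0 ≤ W` whenever `log max(3,|bⱼ|) ≤ W`. [folklore] -/
theorem W_nonneg_of_hWb {W : ℝ} (hWb : ∀ j, Real.log (max 3 (|S.b j| : ℝ)) ≤ W) : 0 ≤ W :=
  le_trans (Real.log_nonneg (le_trans (by norm_num) (le_max_left _ _))) (hWb S.j₀)

/-- **`log DCs = t₀·log ν(H) + |t|·log|b_{j₀}| + log halfDen`.** [folklore] -/
theorem log_DCs_split (L : Fin S.n → ℕ) (H : ℕ) (s₁ : ℤ) (τ : Tau S.n) :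
    Real.log (S.DCs L H s₁ τ : ℝ) = τ.1 * Real.log (Nat.lcmUpto H : ℝ) + (∑ k, τ.2 k : ℕ) * Real.log (((S.b S.j₀).natAbs : ℕ) : ℝ) +
      Real.log (S.halfDen L s₁ : ℝ) := by
  have hν : (0 : ℝ) < (Nat.lcmUpto H : ℝ) := by exact_mod_cast Nat.lcmUpto_pos H
  have hb1 : (1 : ℝ) ≤ (((S.b S.j₀).natAbs : ℕ) : ℝ) := by exact_mod_cast Int.natAbs_pos.mpr S.bj₀_ne
  have hd1 : (1 : ℝ) ≤ (S.halfDen L s₁ : ℝ) := by exact_mod_cast S.one_le_halfDen L s₁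
  unfold DCs
  push_cast
  rw [Real.log_mul (by positivity) (by positivity), Real.log_mul (by positivity) (by positivity), Real.log_pow, Real.log_pow]
  push_cast
  ring

/-- **`log ∏H(α) ≤ Σ Vⱼ`** when `h(αⱼ) ≤ Vⱼ`. [folklore] -/
theorem log_heightProd_le_of_le {V : Fin S.n → ℝ} (hV : ∀ j, Height.logHeight₁ (S.α j) ≤ V j) :
    Real.log (CW77.heightProd S.α) ≤ ∑ j, V j := by
  unfold CW77.heightProd
  rw [Real.log_prod (s := Finset.univ) (fun j _ => (lt_of_lt_of_le one_pos (CW77.one_le_hgt (S.α j))).ne')]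
  exact Finset.sum_le_sum fun j _ => by rw [CW77.log_hgt_eq_logHeight₁]; exact hV j

/-- The joint (S1) height charge: **`2·log halfDen + log halfHgtR ≤ 4|s₁|·Σⱼ Lⱼ Vⱼ`** when `h(αⱼ) ≤ Vⱼ`. [cite: Nesterenko2003, §3.2; shape only] -/
theorem height_charge_le (L : Fin S.n → ℕ) (s₁ : ℤ) {V : Fin S.n → ℝ} (hV : ∀ j, Height.logHeight₁ (S.α j) ≤ V j) :
    2 * Real.log (S.halfDen L s₁ : ℝ) + Real.log (S.halfHgtR L s₁) ≤ 4 * |(s₁ : ℝ)| * ∑ j, (L j : ℝ) * V j := by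
  have h := S.two_mul_log_halfDen_add_le L s₁
  rw [S.sum_halfE_mul_eq] at h
  have hsum : ∑ j, (L j : ℝ) * Height.logHeight₁ (S.α j) ≤ ∑ j, (L j : ℝ) * V j :=
    Finset.sum_le_sum fun j _ => mul_le_mul_of_nonneg_left (hV j) (Nat.cast_nonneg _)
  have hs : 0 ≤ |(s₁ : ℝ)| := abs_nonneg _
  nlinarith [mul_le_mul_of_nonneg_left hsum (by positivity : (0 : ℝ) ≤ 2 * |(s₁ : ℝ)|)]

/-! ### The per-degree cost of the half-step threshold -/

/-- **Per-degree cost of the half-step threshold from slot ceilings.**  At an admissible `(lev, s₁, τ)`: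
`log 4 + 2·log DCs + log(1 + U·P·MhCs) + 3·log ∏H(α)
 ≤ log 4 + 3 log 2 + 2cU + cA + H/e + 3ΣV + cL + (t₀ + |t|)·max(3cν + (Ŝ−lev) log 2, 2W + cX) + 4|s₁|·cS`.
[cite: Nesterenko2003, §4.3 (4.41); shape only] -/
theorem perDegreeH_le {W : ℝ} (hWb : ∀ j, Real.log (max 3 (|S.b j| : ℝ)) ≤ W)
    {V : Fin S.n → ℝ} (hV : ∀ j, Height.logHeight₁ (S.α j) ≤ V j)
    {cν cU cA : ℝ} (hν : Real.log (Nat.lcmUpto Sc.H : ℝ) ≤ cν)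
    (hcU : Real.log (S.UcardS₂ Sc : ℝ) ≤ cU) (hcA : Real.log (S.AmaxS₂ Sc) ≤ cA)
    {lev : ℕ} (hlev : lev < Sc.Sd) (s₁ : ℤ) (τ : Tau S.n)
    {cX cS cL : ℝ}
    (hcX : Real.log (max 1 (S.XbC (S.Lb (S.sideS₂ Sc) lev) : ℝ)) ≤ cX)
    (hcS : ∑ j, (S.Lb (S.sideS₂ Sc) lev j : ℝ) * V j ≤ cS)
    (hcL : (Sc.L₀ : ℝ) * (1 + Real.log (1 + |((2 ^ (Sc.Sd - (lev + 1)) * s₁ : ℤ) : ℝ)| / Sc.H)) ≤ cL) :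
    Real.log 4 + 2 * Real.log (S.DCs (S.Lb (S.sideS₂ Sc) lev) Sc.H s₁ τ : ℝ) +
        Real.log (1 + (S.UcardS₂ Sc : ℝ) * (S.PmaxS₂ Sc) * S.MhCs (S.Lb (S.sideS₂ Sc) lev) Sc.L₀ Sc.H Sc.Sd lev s₁ τ) +
        3 * Real.log (CW77.heightProd S.α) ≤
      Real.log 4 + 3 * Real.log 2 + 2 * cU + cA + Sc.H / Real.exp 1 + 3 * ∑ j, V j + cL +
        ((τ.1 : ℝ) + (∑ k, τ.2 k : ℕ)) * max (3 * cν + ((Sc.Sd - lev : ℕ) : ℝ) * Real.log 2) (2 * W + cX) +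
        4 * |(s₁ : ℝ)| * cS := by
  set L := S.Lb (S.sideS₂ Sc) lev with hL
  have hU1 := S.UcardS₂_one_le Sc
  have hP1 := S.one_le_PmaxS₂ Sc
  -- the slots
  have hD := S.log_DCs_split L Sc.H s₁ τ
  have hb := S.log_natAbs_bj₀_le hWb
  have hMh := S.log_one_add_UPMhCs_le hU1 hP1 L Sc.L₀ Sc.H Sc.Sd lev s₁ τ
  have hM0 := log_M0C_le' Sc.L₀ Sc.H Sc.Sd (lev + 1) s₁ τ.1
  have hPm := S.log_PmaxS₂_le Sc
  have hhP := S.log_heightProd_le_of_le hV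
  have hhc := S.height_charge_le L s₁ hV
  -- signs
  have ht0 : (0 : ℝ) ≤ τ.1 := Nat.cast_nonneg _
  have hst : (0 : ℝ) ≤ ((∑ k, τ.2 k : ℕ) : ℝ) := Nat.cast_nonneg _
  have hW0 : 0 ≤ W := S.W_nonneg_of_hWb hWb
  have hs0 : 0 ≤ |(s₁ : ℝ)| := abs_nonneg _
  have hLV0 : 0 ≤ ∑ j, (L j : ℝ) * V j :=
    Finset.sum_nonneg fun j _ => mul_nonneg (Nat.cast_nonneg _) (le_trans (Height.zero_le_logHeight₁ _) (hV j))
  -- the exponent bookkeeping `(Ŝ − (lev+1))·t₀ + t₀ = (Ŝ − lev)·t₀`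
  have hSd : (((Sc.Sd - (lev + 1)) * τ.1 : ℕ) : ℝ) * Real.log 2 + τ.1 * Real.log 2 = ((Sc.Sd - lev : ℕ) : ℝ) * Real.log 2 * τ.1 := by
    have h1 : (Sc.Sd - (lev + 1)) * τ.1 + τ.1 = (Sc.Sd - lev) * τ.1 := by
      have : Sc.Sd - lev = (Sc.Sd - (lev + 1)) + 1 := by omega
      rw [this]; ring
    have h2 : (((Sc.Sd - (lev + 1)) * τ.1 : ℕ) : ℝ) + τ.1 = ((Sc.Sd - lev : ℕ) : ℝ) * τ.1 := by exact_mod_cast h1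
    calc (((Sc.Sd - (lev + 1)) * τ.1 : ℕ) : ℝ) * Real.log 2 + τ.1 * Real.log 2
        = ((((Sc.Sd - (lev + 1)) * τ.1 : ℕ) : ℝ) + τ.1) * Real.log 2 := by ring
      _ = ((Sc.Sd - lev : ℕ) : ℝ) * Real.log 2 * τ.1 := by rw [h2]; ring
  -- `t₀`-terms and `|t|`-terms against the max
  set A : ℝ := 3 * cν + ((Sc.Sd - lev : ℕ) : ℝ) * Real.log 2 with hA
  set B : ℝ := 2 * W + cX with hB
  have hAm : A ≤ max A B := le_max_left _ _
  have hBm : B ≤ max A B := le_max_right _ _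
  have ht0A : (τ.1 : ℝ) * A ≤ τ.1 * max A B := mul_le_mul_of_nonneg_left hAm ht0
  have hstB : ((∑ k, τ.2 k : ℕ) : ℝ) * B ≤ ((∑ k, τ.2 k : ℕ) : ℝ) * max A B := mul_le_mul_of_nonneg_left hBm hst
  -- `t₀ log ν ≤ t₀ cν`, `|t| log|b| ≤ |t| W`, `|t| log max(1,XbC) ≤ |t| cX`
  have h1 : (τ.1 : ℝ) * Real.log (Nat.lcmUpto Sc.H : ℝ) ≤ τ.1 * cν := mul_le_mul_of_nonneg_left hν ht0
  have h2 : ((∑ k, τ.2 k : ℕ) : ℝ) * Real.log (((S.b S.j₀).natAbs : ℕ) : ℝ) ≤ ((∑ k, τ.2 k : ℕ) : ℝ) * W :=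
    mul_le_mul_of_nonneg_left hb hst
  have h3 : ((∑ k, τ.2 k : ℕ) : ℝ) * Real.log (max 1 (S.XbC L : ℝ)) ≤ ((∑ k, τ.2 k : ℕ) : ℝ) * cX :=
    mul_le_mul_of_nonneg_left hcX hst
  -- the height charge against `cS`
  have h4 : 4 * |(s₁ : ℝ)| * ∑ j, (L j : ℝ) * V j ≤ 4 * |(s₁ : ℝ)| * cS := mul_le_mul_of_nonneg_left hcS (by positivity)
  -- assemble
  have key : 2 * Real.log (S.DCs L Sc.H s₁ τ : ℝ) +
      Real.log (1 + (S.UcardS₂ Sc : ℝ) * (S.PmaxS₂ Sc) * S.MhCs L Sc.L₀ Sc.H Sc.Sd lev s₁ τ) ≤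
      3 * Real.log 2 + 2 * cU + cA + Sc.H / Real.exp 1 + cL + (τ.1 : ℝ) * A + ((∑ k, τ.2 k : ℕ) : ℝ) * B + 4 * |(s₁ : ℝ)| * cS := by
    rw [hD]
    have e : (τ.1 : ℝ) * A = 2 * (τ.1 * cν) + (((Sc.Sd - lev : ℕ) : ℝ) * Real.log 2 * τ.1 + τ.1 * cν) := by rw [hA]; ring
    rw [e, ← hSd, hB]
    have e2 : ((∑ k, τ.2 k : ℕ) : ℝ) * (2 * W + cX) = 2 * (((∑ k, τ.2 k : ℕ) : ℝ) * W) + ((∑ k, τ.2 k : ℕ) : ℝ) * cX := by ring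
    rw [e2]
    linarith
  have e3 : ((τ.1 : ℝ) + (∑ k, τ.2 k : ℕ)) * max A B = (τ.1 : ℝ) * max A B + ((∑ k, τ.2 k : ℕ) : ℝ) * max A B := by ring
  rw [e3]
  linarith

/-! ### The gain line from the slots -/

/-- **THE KUMMER HALF-STEP GAIN LINE FROM SLOT CEILINGS** (every schedule): under the ceilings listed in the module docstring and the per-level
budget `hB`, the `hgain` hypothesis of `hH_of_lines` / `hH_of_lamLines` holds verbatim. [cite: Nesterenko2003, §4.3 (4.39)–(4.45); shape only] -/
theorem hgainH_of_slots {W : ℝ} (hWb : ∀ j, Real.log (max 3 (|S.b j| : ℝ)) ≤ W)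
    {V : Fin S.n → ℝ} (hV : ∀ j, Height.logHeight₁ (S.α j) ≤ V j)
    {cν cU cA : ℝ} (hν : Real.log (Nat.lcmUpto Sc.H : ℝ) ≤ cν) (hcν : 0 ≤ cν)
    (hcU : Real.log (S.UcardS₂ Sc : ℝ) ≤ cU) (hcA : Real.log (S.AmaxS₂ Sc) ≤ cA)
    {cX cS cL Tq : ℕ → ℝ}
    (hcX : ∀ lev < Sc.Sd, Real.log (max 1 (S.XbC (S.Lb (S.sideS₂ Sc) lev) : ℝ)) ≤ cX lev)
    (hcS : ∀ lev < Sc.Sd, ∑ j, (S.Lb (S.sideS₂ Sc) lev j : ℝ) * V j ≤ cS lev)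
    (hcS0 : ∀ lev < Sc.Sd, 0 ≤ cS lev)
    (hcL : ∀ lev < Sc.Sd, ∀ s₁ : ℤ, |s₁| ≤ (2 * S.NhS Sc (lev + 1) - 1 : ℤ) →
      (Sc.L₀ : ℝ) * (1 + Real.log (1 + |((2 ^ (Sc.Sd - (lev + 1)) * s₁ : ℤ) : ℝ)| / Sc.H)) ≤ cL lev)
    (hTq : ∀ lev < Sc.Sd, ((S.TordS Sc lev S.n : ℕ) : ℝ) - S.tS Sc lev ≤ Tq lev)
    (hB : ∀ lev < Sc.Sd,
      Real.log (BwP (p := p) Sc.L₀ Sc.m) + (((2 ^ (S.n + 1) : ℕ) : ℝ)) *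
          (Real.log 4 + 3 * Real.log 2 + 2 * cU + cA + Sc.H / Real.exp 1 + 3 * ∑ j, V j + cL lev +
            Tq lev * max (3 * cν + ((Sc.Sd - lev : ℕ) : ℝ) * Real.log 2) (2 * W + cX lev) +
            4 * (2 * (S.NhS Sc (lev + 1) : ℝ) - 1) * cS lev) <
        (((2 * S.NS Sc lev S.n + 1) * S.tS Sc lev : ℕ) : ℝ) * (((Sc.m : ℝ) + 1 / 2) * Real.log p)) :
    ∀ lev < Sc.Sd, ∀ s₁ : ℤ, Odd s₁ → |s₁| ≤ (2 * S.NhS Sc (lev + 1) - 1 : ℤ) → ∀ τ : Tau S.n, tauNorm τ + S.tS Sc lev ≤ S.TordS Sc lev S.n →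
      Real.log (BwP (p := p) Sc.L₀ Sc.m) +
          (((2 ^ (S.n + 1) : ℕ) : ℝ)) * (Real.log 4 + 2 * Real.log (S.DCs (S.Lb (S.sideS₂ Sc) lev) Sc.H s₁ τ : ℝ) +
            Real.log (1 + (S.UcardS₂ Sc : ℝ) * (S.PmaxS₂ Sc) * S.MhCs (S.Lb (S.sideS₂ Sc) lev) Sc.L₀ Sc.H Sc.Sd lev s₁ τ) +
            3 * Real.log (CW77.heightProd S.α)) -
          Real.log (S.DCs (S.Lb (S.sideS₂ Sc) lev) Sc.H s₁ τ : ℝ) <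
        (((2 * S.NS Sc lev S.n + 1) * S.tS Sc lev : ℕ) : ℝ) * (((Sc.m : ℝ) + 1 / 2) * Real.log p) := by
  intro lev hlev s₁ _hs₁ hs₁' τ hτ
  have hper := S.perDegreeH_le Sc hWb hV hν hcU hcA hlev s₁ τ (hcX lev hlev) (hcS lev hlev) (hcL lev hlev s₁ hs₁')
  have hBl := hB lev hlev
  -- `−log DCs ≤ 0`
  have hD0 : 0 ≤ Real.log (S.DCs (S.Lb (S.sideS₂ Sc) lev) Sc.H s₁ τ : ℝ) :=
    Real.log_nonneg (by exact_mod_cast S.one_le_DCs _ _ _ _)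
  -- `t₀ + |t| ≤ Tq lev`
  have hτ' : (τ.1 : ℝ) + ((∑ k, τ.2 k : ℕ) : ℝ) ≤ Tq lev := by
    have h1 : ((τ.1 + ∑ k, τ.2 k + S.tS Sc lev : ℕ) : ℝ) ≤ (S.TordS Sc lev S.n : ℕ) := by
      have : tauNorm τ = τ.1 + ∑ k, τ.2 k := rfl
      exact_mod_cast (this ▸ hτ)
    have h2 := hTq lev hlev
    push_cast at h1 h2 ⊢
    linarith
  -- `|s₁| ≤ 2 NhS − 1`
  have hs : |(s₁ : ℝ)| ≤ 2 * (S.NhS Sc (lev + 1) : ℝ) - 1 := by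
    have := hs₁'
    rw [← Int.cast_abs]
    exact_mod_cast this
  -- monotone in `(t₀+|t|)` and `|s₁|`
  have hmax0 : 0 ≤ max (3 * cν + ((Sc.Sd - lev : ℕ) : ℝ) * Real.log 2) (2 * W + cX lev) :=
    le_trans (by positivity) (le_max_left _ _)
  have hm1 : ((τ.1 : ℝ) + ((∑ k, τ.2 k : ℕ) : ℝ)) * max (3 * cν + ((Sc.Sd - lev : ℕ) : ℝ) * Real.log 2) (2 * W + cX lev) ≤
      Tq lev * max (3 * cν + ((Sc.Sd - lev : ℕ) : ℝ) * Real.log 2) (2 * W + cX lev) :=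
    mul_le_mul_of_nonneg_right hτ' hmax0
  have hm2 : 4 * |(s₁ : ℝ)| * cS lev ≤ 4 * (2 * (S.NhS Sc (lev + 1) : ℝ) - 1) * cS lev :=
    mul_le_mul_of_nonneg_right (by linarith) (hcS0 lev hlev)
  have h2n : (0 : ℝ) ≤ ((2 ^ (S.n + 1) : ℕ) : ℝ) := Nat.cast_nonneg _
  have hin : Real.log 4 + 2 * Real.log (S.DCs (S.Lb (S.sideS₂ Sc) lev) Sc.H s₁ τ : ℝ) +
        Real.log (1 + (S.UcardS₂ Sc : ℝ) * (S.PmaxS₂ Sc) * S.MhCs (S.Lb (S.sideS₂ Sc) lev) Sc.L₀ Sc.H Sc.Sd lev s₁ τ) +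
        3 * Real.log (CW77.heightProd S.α) ≤
      Real.log 4 + 3 * Real.log 2 + 2 * cU + cA + Sc.H / Real.exp 1 + 3 * ∑ j, V j + cL lev +
        Tq lev * max (3 * cν + ((Sc.Sd - lev : ℕ) : ℝ) * Real.log 2) (2 * W + cX lev) +
        4 * (2 * (S.NhS Sc (lev + 1) : ℝ) - 1) * cS lev := by linarith
  have hmul := mul_le_mul_of_nonneg_left hin h2n
  linarith

end G3Setup

end Summit.ABC.StewartYu

end
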